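import Literature.NumberTheory.Transcendental.RoySmallValueCoprimeQ
import Mathlib.Algebra.Polynomial.Roots
import Mathlib.Data.Fintype.Pigeonhole
import Mathlib.Algebra.Group.Irreducible.Lemmas
import HarnessLib

/-!
# Small value estimates at rational translates (Nguyen–Roy 2016) — proofs: Lemma 13 (no common factor of the translates)

Proofs file towards `Literature.NumberTheory.Transcendental.nguyenRoy2016_thm_1` (Nguyen–Roy,
*A small value estimate in dimension two involving translations by rational points*, IJNT 12 (2016)
= arXiv:1412.5163, Theorem 1). Everything here is PROVED; one auxiliary definition with a body
(`tauEquiv`, the translation as an algebra automorphism) and the exponent shorthand `ex`; no named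
facts.

**Lemma 13** of the paper, as printed (projective form, over `ℂ[X] = ℂ[X₀, X₁, X₂]`): *let
`D ∈ ℕ*` and `P ∈ ℂ[X]_D` not divisible by `X₀` nor by `X₂`; then `P, Φ(P), …, Φ^D(P)` have no
common irreducible factor in `ℂ[X]`*, where `Φ(P)(X) = P(X₀, X₁ + rX₀, sX₂)` is the translation by
the rational point `(r, s)`, `r ≠ 0`, `s ≠ 0, ±1` — in the tree's vocabulary `Φ = Roy2013.tau r s`
and `Φⁱ = Roy2013.tau (ir) (sⁱ)` (`tau_iterate_eq`). We follow the printed proof: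

* `eq_monomial_of_tau_eq_smul` — *the eigenvectors of `Φᵏ` on `ℂ[X]_t` are the monomials
  `a X₀^{t−i} X₂^i`*: if `Q ∈ ℂ[X]_t`, `Q ≠ 0` and `τ_{(ρ,θ)} Q = c Q` with `ρ ≠ 0`, `θ ≠ 0` not a
  root of unity, then `Q = a X₀^{t−i} X₂^i`. (Printed: "`ℂ[X]_t = ⊕ X₂^i ℂ[X₀,X₁]_{t−i}` is a
  decomposition into invariant subspaces and the restriction of `Φᵏ` to `X₂^i ℂ[X₀,X₁]_{t−i}`
  admits `s^{ik}` as its only eigenvalue with eigenspace `ℂ X₀^{t−i} X₂^i`".) The proof is by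
  coefficients (`coeff_tau`): comparing the coefficient at the monomial of maximal `X₁`-degree in
  each `X₂`-degree `b` gives `c = θ^b`, so a single `b = i` occurs; then the coefficient of
  `X₀^{t−i} X₂^i` in `τ_{(nρ, θⁿ)} Q = θ^{in} Q` (`n ∈ ℕ`) shows that the univariate polynomial
  `∑_μ q_μ Y^{μ₁}` is constant on `ℕρ`, hence constant: no `X₁` occurs.
* `lemma13` — **Lemma 13**: an irreducible `R` dividing `Φⁱ P` for `0 ≤ i ≤ D` gives `D + 1`
  irreducible factors `Φᵏ R` (`0 ≤ k ≤ D`) of the form `Φ^D P` of degree `D`, which has at most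
  `D` prime factors (`Roy2013.card_factors_le`); so two of them are associated, whence
  `Φᵏ R = c R` for some `0 < k ≤ D`, `R = a X₀^{t−i} X₂^i` with `t ≥ 1`, and `X₀ ∣ P` or `X₂ ∣ P`.
* `exists_coprime_iterate_combination`, `exists_coprime_tau_combination` — the consequence used in
  the proof of **Proposition 14** (and, for `𝒟`, of [R2012, Prop. 6.4]): *there exist integers
  `a₁, …, a_D` such that `Q := ∑ aᵢ Φⁱ(P)` is relatively prime to `P`*, here with `aᵢ = tⁱ`,
  `t ≤ D²`, by the counting argument of the tree's `Roy2013.exists_coprime_deriv_combination`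
  (seat-B file `RoySmallValueCoprimeQ`), run for an arbitrary self-map `Φ` of `ℂ[X]`.
* `lemma13_rat`, `exists_coprime_tau_combination_rat` — the same for `(r, s) ∈ ℚ* × ℚ*`,
  `s ≠ ±1` (the hypotheses of Theorem 1), `sᵏ ≠ 1` for `k ≥ 1` being `rat_cast_pow_ne_one`.

The affine form of Lemma 13 over `ℚ(x)[Y]` used for the remark of §1 is file I
(`RoySmallValueEstimatesProofs`); the present projective form is the one quoted in the proofs of
Propositions 14 and 15.

## References

* [NguyenRoy2016] N. A. V. Nguyen, D. Roy, IJNT 12 (2016) 1273–1293 = arXiv:1412.5163, §2 (the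
  automorphism `Φ`), §4 Lemma 13 and its proof, §5 proof of Proposition 14 (the polynomial `Q`).
* [Roy2013] D. Roy, Mathematika 59 (2013) = arXiv:1301.0663, §3 (`τ_γ`), §6 proof of Prop. 6.4.
-/

noncomputable section

open MvPolynomial Finset

namespace Literature.NumberTheory.Transcendental

namespace NguyenRoy

open Roy2013 (CX tau tau_tau tau_zero_one tau_neg_tau isHomogeneous_tau isHomogeneous_of_dvd
  card_factors_le totalDegree_pos_of_not_isUnit)

/-! ### Exponents in three variables -/

/-- The exponent `(a, j, b)` of the monomial `X₀^a X₁^j X₂^b`. [folklore] -/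
def ex (a j b : ℕ) : Fin 3 →₀ ℕ :=
  Finsupp.single 0 a + Finsupp.single 1 j + Finsupp.single 2 b

/-- `(a, j, b)₀ = a`. [folklore] -/
@[simp] theorem ex_zero (a j b : ℕ) : ex a j b 0 = a := by simp [ex]

/-- `(a, j, b)₁ = j`. [folklore] -/
@[simp] theorem ex_one (a j b : ℕ) : ex a j b 1 = j := by simp [ex]

/-- `(a, j, b)₂ = b`. [folklore] -/
@[simp] theorem ex_two (a j b : ℕ) : ex a j b 2 = b := by simp [ex]

/-- Every exponent is an `ex`. [folklore] -/
theorem ex_eta (μ : Fin 3 →₀ ℕ) : ex (μ 0) (μ 1) (μ 2) = μ := by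
  ext k
  fin_cases k <;> simp

/-- `|(a, j, b)| = a + j + b`. [folklore] -/
theorem degree_ex (a j b : ℕ) : (ex a j b).degree = a + j + b := by
  simp only [ex, map_add, Finsupp.degree_single]

/-- `|μ| = μ₀ + μ₁ + μ₂`. [folklore] -/
theorem degree_eq_add (μ : Fin 3 →₀ ℕ) : μ.degree = μ 0 + μ 1 + μ 2 := by
  have h := degree_ex (μ 0) (μ 1) (μ 2)
  rwa [ex_eta] at h

/-- `X^{(a,j,b)} = X₀^a X₁^j X₂^b`. [folklore] -/
theorem monomial_ex (a j b : ℕ) (c : ℂ) :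
    (monomial (ex a j b) c : CX) = C c * X 0 ^ a * X 1 ^ j * X 2 ^ b := by
  rw [monomial_eq, Finsupp.prod_fintype _ _ (fun i => by rw [pow_zero]), Fin.prod_univ_three,
    ex_zero, ex_one, ex_two, mul_assoc, mul_assoc, mul_assoc]

/-! ### The translation on monomials and on coefficients -/

/-- `τ_{(ρ,θ)}(c X₀^a X₁^j X₂^b) = ∑_l c binom(j,l) ρ^{j−l} θ^b X₀^{a+j−l} X₁^l X₂^b`.
[cite: NguyenRoy2016, proof of Lemma 13] -/
theorem tau_monomial (ρ θ : ℂ) (a j b : ℕ) (c : ℂ) :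
    tau ρ θ (monomial (ex a j b) c) =
      ∑ l ∈ range (j + 1), monomial (ex (a + (j - l)) l b)
        (c * (j.choose l : ℂ) * ρ ^ (j - l) * θ ^ b) := by
  rw [monomial_ex, map_mul, map_mul, map_mul, map_pow, map_pow, map_pow, algHom_C, algebraMap_eq,
    Roy2013.tau_X_zero, Roy2013.tau_X_one, Roy2013.tau_X_two, add_comm (C ρ * X 0) (X 1), add_pow,
    Finset.mul_sum, Finset.sum_mul]
  refine Finset.sum_congr rfl fun l _ => ?_
  rw [monomial_ex, mul_pow, mul_pow, ← C_pow, ← C_pow, ← map_natCast (C : ℂ →+* CX) (j.choose l),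
    C_mul, C_mul, C_mul, pow_add]
  ring

/-- The coefficients of `τ_{(ρ,θ)}(c X^{(a,j,b)})`. [cite: NguyenRoy2016, proof of Lemma 13] -/
theorem coeff_tau_monomial (ρ θ : ℂ) (a j b : ℕ) (c : ℂ) (ν : Fin 3 →₀ ℕ) :
    coeff ν (tau ρ θ (monomial (ex a j b) c)) =
      if ν 2 = b ∧ ν 1 ≤ j ∧ ν 0 + ν 1 = a + j then
        c * (j.choose (ν 1) : ℂ) * ρ ^ (j - ν 1) * θ ^ b else 0 := by
  classical
  rw [tau_monomial, coeff_sum]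
  simp_rw [coeff_monomial]
  split_ifs with h
  · obtain ⟨h2, h1, h0⟩ := h
    rw [Finset.sum_eq_single (ν 1)]
    · rw [if_pos]
      conv_rhs => rw [← ex_eta ν]
      rw [h2, show a + (j - ν 1) = ν 0 by omega]
    · intro l _ hne
      rw [if_neg]
      intro heq
      apply hne
      have := congrArg (fun e : Fin 3 →₀ ℕ => e 1) heq
      simpa using this
    · intro hν
      exact absurd (mem_range.mpr (Nat.lt_succ_of_le h1)) hν
  · refine Finset.sum_eq_zero fun l hl => ?_
    rw [if_neg]
    intro heq
    apply h
    have e0 := congrArg (fun e : Fin 3 →₀ ℕ => e 0) heq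
    have e1 := congrArg (fun e : Fin 3 →₀ ℕ => e 1) heq
    have e2 := congrArg (fun e : Fin 3 →₀ ℕ => e 2) heq
    simp only [ex_zero, ex_one, ex_two] at e0 e1 e2
    have hl' := mem_range.mp hl
    refine ⟨e2.symm, ?_, ?_⟩ <;> omega

/-- **The coefficients of a translate**: `[X^ν] τ_{(ρ,θ)} Q = ∑_μ q_μ binom(μ₁,ν₁) ρ^{μ₁−ν₁} θ^{μ₂}`
over the exponents `μ` of `Q` with `μ₂ = ν₂`, `μ₁ ≥ ν₁`, `μ₀ + μ₁ = ν₀ + ν₁`.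
[cite: NguyenRoy2016, proof of Lemma 13] -/
theorem coeff_tau (ρ θ : ℂ) (Q : CX) (ν : Fin 3 →₀ ℕ) :
    coeff ν (tau ρ θ Q) = ∑ μ ∈ Q.support,
      (if ν 2 = μ 2 ∧ ν 1 ≤ μ 1 ∧ ν 0 + ν 1 = μ 0 + μ 1 then
        coeff μ Q * ((μ 1).choose (ν 1) : ℂ) * ρ ^ (μ 1 - ν 1) * θ ^ (μ 2) else 0) := by
  conv_lhs => rw [Q.as_sum, map_sum, coeff_sum]
  refine Finset.sum_congr rfl fun μ _ => ?_
  have h := coeff_tau_monomial ρ θ (μ 0) (μ 1) (μ 2) (coeff μ Q) ν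
  rwa [ex_eta] at h

/-- Iterates of the translation: `τ_{(ρ,θ)}ⁿ = τ_{(nρ, θⁿ)}` (`Φⁱ(P)(X) = P(X₀, X₁ + irX₀, sⁱX₂)`).
[cite: NguyenRoy2016, §2] -/
theorem tau_iterate_eq (ρ θ : ℂ) (n : ℕ) (Q : CX) :
    (tau ρ θ)^[n] Q = tau (n * ρ) (θ ^ n) Q := by
  induction n generalizing Q with
  | zero => simp
  | succ n ih =>
    rw [Function.iterate_succ_apply', ih, tau_tau, pow_succ',
      show ((n + 1 : ℕ) : ℂ) * ρ = ρ + n * ρ by push_cast; ring]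

/-- The translation as an algebra automorphism of `ℂ[X]` (inverse `τ_{(−ρ, θ⁻¹)}`, `θ ≠ 0`).
[cite: NguyenRoy2016, §2 ("degree preserving ℂ-algebra automorphism")] -/
def tauEquiv (ρ θ : ℂ) (hθ : θ ≠ 0) : CX ≃ₐ[ℂ] CX :=
  AlgEquiv.ofAlgHom (tau ρ θ) (tau (-ρ) θ⁻¹)
    (AlgHom.ext fun P => by
      rw [AlgHom.comp_apply, tau_tau, add_neg_cancel, mul_inv_cancel₀ hθ, AlgHom.id_apply]
      exact tau_zero_one P)
    (AlgHom.ext fun P => by rw [AlgHom.comp_apply, AlgHom.id_apply]; exact tau_neg_tau hθ P)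

/-- `tauEquiv` acts as `τ`. [folklore] -/
theorem tauEquiv_apply (ρ θ : ℂ) (hθ : θ ≠ 0) (P : CX) : tauEquiv ρ θ hθ P = tau ρ θ P := rfl

/-! ### Eigenvectors of the translations -/

/-- **Eigenvectors of `Φᵏ` on `ℂ[X]_t`.** If `Q ∈ ℂ[X]_t` is non-zero and `τ_{(ρ,θ)} Q = c Q` with
`ρ ≠ 0` and `θ ≠ 0` not a root of unity, then `Q = a X₀^{t−i} X₂^i` for some `0 ≤ i ≤ t`
("the restriction of `Φᵏ` to `X₂^i ℂ[X₀,X₁]_{t−i}` admits `s^{ik}` as its only eigenvalue, with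
`ℂ X₀^{t−i}X₂^i` as its corresponding eigenspace; since `1, sᵏ, …, s^{tk}` are all distinct,
`Q = a X₀^{t−i} X₂^i`"). [cite: NguyenRoy2016, proof of Lemma 13] -/
theorem eq_monomial_of_tau_eq_smul {Q : CX} {t : ℕ} (hQ : Q.IsHomogeneous t) (hQ0 : Q ≠ 0)
    {ρ θ c : ℂ} (hρ : ρ ≠ 0) (hθ0 : θ ≠ 0) (hθ : ∀ k : ℕ, 0 < k → θ ^ k ≠ 1)
    (h : tau ρ θ Q = c • Q) :
    ∃ (i : ℕ) (a : ℂ), i ≤ t ∧ Q = monomial (ex (t - i) 0 i) a := by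
  classical
  -- degrees of the exponents of `Q`
  have hdeg : ∀ μ ∈ Q.support, μ 0 + μ 1 + μ 2 = t := by
    intro μ hμ
    have h1 : μ.degree = t := by
      by_contra hd
      exact (mem_support_iff.mp hμ) (hQ.coeff_eq_zero hd)
    rw [degree_eq_add] at h1
    exact h1
  -- iterates `τ_{(nρ, θⁿ)} Q = cⁿ Q`
  have hn : ∀ n : ℕ, tau (n * ρ) (θ ^ n) Q = c ^ n • Q := by
    intro n
    induction n with
    | zero => simp
    | succ n ih =>
      rw [pow_succ', show ((n + 1 : ℕ) : ℂ) * ρ = ρ + n * ρ by push_cast; ring, ← tau_tau, ih,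
        map_smul, h, smul_smul, pow_succ]
  -- Step 1: `c = θ^{μ₂}` for every exponent `μ` of `Q` (maximal `X₁`-degree in `X₂`-degree `μ₂`)
  have hA : ∀ μ ∈ Q.support, c = θ ^ (μ 2) := by
    intro μ₁ hμ₁
    obtain ⟨μs, hμs, hmax⟩ := Finset.exists_max_image (Q.support.filter fun μ => μ 2 = μ₁ 2)
      (fun μ => μ 1) ⟨μ₁, mem_filter.mpr ⟨hμ₁, rfl⟩⟩
    have hμs_supp : μs ∈ Q.support := (mem_filter.mp hμs).1
    have hμs2 : μs 2 = μ₁ 2 := (mem_filter.mp hμs).2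
    have key := congrArg (coeff μs) h
    rw [coeff_tau, coeff_smul, Finset.sum_eq_single μs] at key
    · rw [if_pos ⟨rfl, le_rfl, rfl⟩, Nat.choose_self, Nat.sub_self, pow_zero, Nat.cast_one, mul_one,
        mul_one, smul_eq_mul, mul_comm] at key
      rw [← hμs2]
      exact (mul_right_cancel₀ (mem_support_iff.mp hμs_supp) key).symm
    · intro μ hμ hne
      rw [if_neg]
      rintro ⟨h2, h1, h0⟩
      have hle : μ 1 ≤ μs 1 := hmax μ (mem_filter.mpr ⟨hμ, h2.symm.trans hμs2⟩)
      apply hne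
      rw [← ex_eta μ, ← ex_eta μs, show μ 0 = μs 0 by omega, le_antisymm hle h1, h2]
    · intro hns
      exact absurd hμs_supp hns
  -- Step 2: a single `X₂`-degree `i` occurs, and `c = θ^i`
  obtain ⟨μ₀, hμ₀⟩ := support_nonempty.mpr hQ0
  have hpow_inj : ∀ p q : ℕ, θ ^ p = θ ^ q → p = q := by
    intro p q hpq
    by_contra hne
    wlog hlt : p < q generalizing p q
    · exact this q p hpq.symm (Ne.symm hne) (lt_of_le_of_ne (not_lt.mp hlt) (Ne.symm hne))
    apply hθ (q - p) (Nat.sub_pos_of_lt hlt)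
    apply mul_left_cancel₀ (pow_ne_zero p hθ0)
    rw [← pow_add, Nat.add_sub_cancel' hlt.le, mul_one]
    exact hpq.symm
  have hB : ∀ μ ∈ Q.support, μ 2 = μ₀ 2 := fun μ hμ =>
    hpow_inj _ _ ((hA μ hμ).symm.trans (hA μ₀ hμ₀))
  have hc : c = θ ^ (μ₀ 2) := hA μ₀ hμ₀
  set i : ℕ := μ₀ 2 with hi
  have hit : i ≤ t := by have := hdeg μ₀ hμ₀; omega
  set ν₀ : Fin 3 →₀ ℕ := ex (t - i) 0 i with hν₀
  -- Step 3: no `X₁` occurs: the polynomial `∑_μ q_μ Y^{μ₁} − q_{ν₀}` vanishes on `ℕρ`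
  set f : Polynomial ℂ :=
    ∑ μ ∈ Q.support, Polynomial.C (coeff μ Q) * Polynomial.X ^ (μ 1) - Polynomial.C (coeff ν₀ Q)
    with hf
  have hf_eval : ∀ n : ℕ, f.eval ((n : ℂ) * ρ) = 0 := by
    intro n
    have key := congrArg (coeff ν₀) (hn n)
    rw [coeff_tau, coeff_smul, hc, smul_eq_mul, ← pow_mul, Finset.sum_congr rfl
      (g := fun μ => θ ^ (i * n) * (coeff μ Q * ((n : ℂ) * ρ) ^ (μ 1))) ?_, ← Finset.mul_sum] at key
    · have key' := mul_left_cancel₀ (pow_ne_zero _ hθ0) key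
      rw [hf, Polynomial.eval_sub, Polynomial.eval_finsetSum, Polynomial.eval_C, sub_eq_zero]
      simp only [Polynomial.eval_mul, Polynomial.eval_C, Polynomial.eval_pow, Polynomial.eval_X]
      exact key'
    · intro μ hμ
      have h2 := hB μ hμ
      have hd := hdeg μ hμ
      rw [if_pos ⟨by rw [hν₀, ex_two, h2], by rw [hν₀, ex_one]; exact Nat.zero_le _,
        by rw [hν₀, ex_zero, ex_one]; omega⟩]
      rw [hν₀, ex_one, Nat.choose_zero_right, Nat.cast_one, mul_one, Nat.sub_zero, h2, ← pow_mul,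
        mul_comm n i]
      ring
  have hS : Set.Infinite {x : ℂ | f.IsRoot x} := by
    have hinj : Function.Injective (fun n : ℕ => (n : ℂ) * ρ) := fun a b hab =>
      Nat.cast_injective (mul_right_cancel₀ hρ hab)
    exact Set.infinite_of_injective_forall_mem hinj fun n => hf_eval n
  have hf0 : f = 0 := Polynomial.eq_zero_of_infinite_isRoot f hS
  have hC : ∀ μ ∈ Q.support, μ 1 = 0 := by
    intro μ hμ
    by_contra hk
    have hcoef := congrArg (fun g : Polynomial ℂ => g.coeff (μ 1)) hf0
    simp only [hf, Polynomial.coeff_sub, Polynomial.finsetSum_coeff, Polynomial.coeff_C_mul_X_pow,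
      Polynomial.coeff_C, Polynomial.coeff_zero, if_neg hk, sub_zero] at hcoef
    rw [Finset.sum_eq_single μ, if_pos rfl] at hcoef
    · exact (mem_support_iff.mp hμ) hcoef
    · intro μ' hμ' hne
      rw [if_neg]
      intro h1
      apply hne
      have hd := hdeg μ hμ
      have hd' := hdeg μ' hμ'
      have h2 := hB μ hμ
      have h2' := hB μ' hμ'
      rw [← ex_eta μ', ← ex_eta μ, show μ' 0 = μ 0 by omega, ← h1, h2', h2]
    · intro hμn
      exact absurd hμ hμn
  -- conclusion: the support of `Q` is `{ν₀}`
  refine ⟨i, coeff ν₀ Q, hit, ?_⟩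
  have hsub : Q.support ⊆ {ν₀} := by
    intro μ hμ
    have hd := hdeg μ hμ
    have h1 := hC μ hμ
    have h2 := hB μ hμ
    rw [Finset.mem_singleton, ← ex_eta μ, hν₀, h1, h2, show μ 0 = t - i by omega]
  ext μ
  rw [coeff_monomial]
  split_ifs with hμ
  · rw [← hμ]
  · exact notMem_support_iff.mp fun hmem => hμ (Finset.mem_singleton.mp (hsub hmem)).symm

/-! ### Lemma 13 -/

/-- **Nguyen–Roy 2016, Lemma 13.** Let `D ∈ ℕ` and `P ∈ ℂ[X]_D`, `P ≠ 0`, not divisible by `X₀` nor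
by `X₂`, and let `Φ = τ_{(r,s)}` with `r ≠ 0`, `s ≠ 0` not a root of unity (e.g. `s ∈ ℚ`,
`s ≠ 0, ±1`). Then `P, Φ(P), …, Φ^D(P)` have no common irreducible factor in `ℂ[X]`: an irreducible
`R` dividing all of them is impossible. [cite: NguyenRoy2016, Lemma 13] -/
theorem lemma13 {P : CX} {D : ℕ} (hP : P.IsHomogeneous D) (hP0 : P ≠ 0) (hX0 : ¬ X 0 ∣ P)
    (hX2 : ¬ X 2 ∣ P) {r s : ℂ} (hr : r ≠ 0) (hs0 : s ≠ 0) (hs : ∀ k : ℕ, 0 < k → s ^ k ≠ 1)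
    {R : CX} (hirr : Irreducible R) (hdvd : ∀ i ≤ D, R ∣ (tau r s)^[i] P) : False := by
  classical
  -- `P' = Φ^D P`, a non-zero form of degree `D`, divisible by `Φᵏ R` for `0 ≤ k ≤ D`
  set P' : CX := tau (D * r) (s ^ D) P with hP'
  have hP'h : P'.IsHomogeneous D := isHomogeneous_tau _ _ hP
  have hP'0 : P' ≠ 0 := fun h0 =>
    hP0 ((tauEquiv (D * r) (s ^ D) (pow_ne_zero D hs0)).injective (by
      rw [map_zero, tauEquiv_apply]; exact h0))
  have hRk : ∀ k ≤ D, tau (k * r) (s ^ k) R ∣ P' := by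
    intro k hk
    have h := hdvd (D - k) (Nat.sub_le D k)
    rw [tau_iterate_eq] at h
    have h' := map_dvd (tau (k * r) (s ^ k)) h
    rw [tau_tau, ← pow_add, Nat.add_sub_cancel' hk,
      show (k : ℂ) * r + ((D - k : ℕ) : ℂ) * r = D * r by push_cast [Nat.cast_sub hk]; ring] at h'
    exact h'
  have hirrk : ∀ k : ℕ, Irreducible (tau (k * r) (s ^ k) R) := fun k =>
    (MulEquiv.irreducible_iff (tauEquiv (k * r) (s ^ k) (pow_ne_zero k hs0))).mpr hirr
  -- each `Φᵏ R` is associated with a member of `factors P'`; pigeonhole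
  have hex : ∀ k : Fin (D + 1), ∃ q ∈ (UniqueFactorizationMonoid.factors P').toFinset,
      Associated (tau ((k : ℕ) * r) (s ^ (k : ℕ)) R) q := by
    intro k
    obtain ⟨q, hq, hassoc⟩ := UniqueFactorizationMonoid.exists_mem_factors_of_dvd hP'0 (hirrk k)
      (hRk k (Nat.lt_succ_iff.mp k.isLt))
    exact ⟨q, Multiset.mem_toFinset.mpr hq, hassoc⟩
  choose g hg hga using hex
  have hcard : Fintype.card ↥(UniqueFactorizationMonoid.factors P').toFinset <
      Fintype.card (Fin (D + 1)) := by
    rw [Fintype.card_coe, Fintype.card_fin]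
    calc ((UniqueFactorizationMonoid.factors P').toFinset).card
        ≤ Multiset.card (UniqueFactorizationMonoid.factors P') := Multiset.toFinset_card_le _
      _ ≤ D := card_factors_le hP'h hP'0
      _ < D + 1 := Nat.lt_succ_self D
  obtain ⟨k₁, k₂, hne, heq⟩ := Fintype.exists_ne_map_eq_of_card_lt
    (fun k : Fin (D + 1) => (⟨g k, hg k⟩ : ↥(UniqueFactorizationMonoid.factors P').toFinset)) hcard
  have heq' : g k₁ = g k₂ := congrArg Subtype.val heq
  -- two associated translates give an eigen-relation `Φᵏ R = c R`, `0 < k`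
  have hassoc : ∀ {a b : ℕ}, a < b →
      Associated (tau (a * r) (s ^ a) R) (tau (b * r) (s ^ b) R) →
      ∃ c : ℂ, tau ((b - a : ℕ) * r) (s ^ (b - a)) R = c • R := by
    intro a b hab hAB
    have h' := hAB.map (tau (-(a * r)) (s ^ a)⁻¹)
    rw [tau_neg_tau (pow_ne_zero a hs0), tau_tau] at h'
    obtain ⟨u, hu⟩ := h'
    obtain ⟨c, -, hcu⟩ := isUnit_iff_eq_C_of_isReduced.mp u.isUnit
    refine ⟨c, ?_⟩
    have e1 : (-((a : ℂ) * r) + (b : ℂ) * r) = ((b - a : ℕ) : ℂ) * r := by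
      push_cast [Nat.cast_sub hab.le]; ring
    have e2 : (s ^ a)⁻¹ * s ^ b = s ^ (b - a) := by
      rw [pow_sub₀ s hs0 hab.le]; ring
    rw [hcu, e1, e2] at hu
    rw [← hu, smul_eq_C_mul, mul_comm]
  obtain ⟨k, hk, c, hkc⟩ : ∃ k : ℕ, 0 < k ∧ ∃ c : ℂ, tau (k * r) (s ^ k) R = c • R := by
    rcases Nat.lt_or_gt_of_ne (Fin.val_ne_of_ne hne) with hlt | hlt
    · obtain ⟨c, hc'⟩ := hassoc hlt ((hga k₁).trans (by rw [heq']; exact (hga k₂).symm))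
      exact ⟨_, Nat.sub_pos_of_lt hlt, c, hc'⟩
    · obtain ⟨c, hc'⟩ := hassoc hlt ((hga k₂).trans (by rw [← heq']; exact (hga k₁).symm))
      exact ⟨_, Nat.sub_pos_of_lt hlt, c, hc'⟩
  -- `R` is a non-zero form dividing `P`; eigenvector analysis
  have hRP : R ∣ P := by simpa using hdvd 0 (Nat.zero_le _)
  have hRh : R.IsHomogeneous R.totalDegree := isHomogeneous_of_dvd hP hP0 hRP
  obtain ⟨i, a, -, hRi⟩ := eq_monomial_of_tau_eq_smul hRh hirr.ne_zero
    (mul_ne_zero (Nat.cast_ne_zero.mpr hk.ne') hr) (pow_ne_zero k hs0)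
    (fun p hp => by rw [← pow_mul]; exact hs (k * p) (Nat.mul_pos hk hp)) hkc
  have ht : 0 < R.totalDegree := totalDegree_pos_of_not_isUnit hirr.ne_zero hirr.not_isUnit
  rw [monomial_ex, pow_zero, mul_one] at hRi
  rcases Nat.eq_zero_or_pos i with h0 | hipos
  · apply hX0
    refine dvd_trans ?_ hRP
    rw [hRi, h0, Nat.sub_zero, pow_zero, mul_one]
    exact dvd_mul_of_dvd_right (dvd_pow_self (X 0) ht.ne') _
  · apply hX2
    refine dvd_trans ?_ hRP
    rw [hRi]
    exact dvd_mul_of_dvd_right (dvd_pow_self (X 2) hipos.ne') _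

/-- For `s ∈ ℚ`, `s ≠ ±1`: `sᵏ ≠ 1` in `ℂ` for `k ≥ 1`. [folklore] -/
theorem rat_cast_pow_ne_one {s : ℚ} (hs1 : s ≠ 1) (hs2 : s ≠ -1) {k : ℕ} (hk : 0 < k) :
    (s : ℂ) ^ k ≠ 1 := by
  intro h
  have h' : s ^ k = 1 := by exact_mod_cast h
  have habs : |s| ^ k = 1 := by rw [← abs_pow, h', abs_one]
  have h1 : |s| = 1 := (pow_eq_one_iff_of_nonneg (abs_nonneg s) hk.ne').mp habs
  rcases (abs_eq zero_le_one).mp h1 with h | h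
  · exact hs1 h
  · exact hs2 h

/-- **Lemma 13 for a rational translation** `(r, s) ∈ ℚ* × ℚ*`, `s ≠ ±1` (the hypotheses of
Theorem 1). [cite: NguyenRoy2016, Lemma 13] -/
theorem lemma13_rat {P : CX} {D : ℕ} (hP : P.IsHomogeneous D) (hP0 : P ≠ 0) (hX0 : ¬ X 0 ∣ P)
    (hX2 : ¬ X 2 ∣ P) {r s : ℚ} (hr : r ≠ 0) (hs0 : s ≠ 0) (hs1 : s ≠ 1) (hs2 : s ≠ -1)
    {R : CX} (hirr : Irreducible R) (hdvd : ∀ i ≤ D, R ∣ (tau (r : ℂ) (s : ℂ))^[i] P) : False :=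
  lemma13 hP hP0 hX0 hX2 (Rat.cast_ne_zero.mpr hr) (Rat.cast_ne_zero.mpr hs0)
    (fun _ hk => rat_cast_pow_ne_one hs1 hs2 hk) hirr hdvd

/-! ### A combination of the translates coprime to `P` (proof of Proposition 14) -/

/-- Residues: `∑ᵢ tⁱ ΦⁱP mod q` is the value at `t` of `∑ᵢ (ΦⁱP mod q) Yⁱ`. [folklore] -/
theorem mk_sum_pow_smul_iterate_eq_eval (Φ : CX → CX) (q P : CX) (D t : ℕ) :
    Ideal.Quotient.mk (Ideal.span {q}) (∑ i ∈ Icc 1 D, ((t : ℂ) ^ i) • Φ^[i] P) =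
      (∑ i ∈ Icc 1 D, Polynomial.C (Ideal.Quotient.mk (Ideal.span {q}) (Φ^[i] P)) *
        Polynomial.X ^ i).eval (t : CX ⧸ Ideal.span {q}) := by
  rw [map_sum, Polynomial.eval_finsetSum]
  refine Finset.sum_congr rfl fun i _ => ?_
  rw [Polynomial.eval_mul, Polynomial.eval_C, Polynomial.eval_pow, Polynomial.eval_X, smul_eq_C_mul,
    map_mul, mul_comm]
  congr 1
  rw [C_pow, map_pow, map_natCast, map_natCast]

/-- **A combination `Q = ∑_{i=1}^D tⁱ Φⁱ P` coprime to `P`** (`t ≤ D²`), for a form `P ∈ ℂ[X]_D`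
and any self-map `Φ` of `ℂ[X]` such that `P, ΦP, …, Φ^D P` have no common irreducible factor: for
each of the at most `D` prime factors `q` of `P`, the `t` with `q ∣ ∑ tⁱ ΦⁱP` are roots of a
non-zero polynomial of degree `≤ D` over `ℂ[X]/(q)`. (The argument of the tree's
`Roy2013.exists_coprime_deriv_combination`, verbatim, for a general `Φ`.)
[cite: NguyenRoy2016, proof of Proposition 14 ("there exist integers a₁,…,a_D … such that Q := ∑ aᵢΦⁱ(P) is relatively prime to P")] -/
theorem exists_coprime_iterate_combination {P : CX} {D : ℕ} (hP : P.IsHomogeneous D) (hP0 : P ≠ 0)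
    (Φ : CX → CX) (hΦ : ∀ R : CX, Irreducible R → (∀ i ≤ D, R ∣ Φ^[i] P) → False) :
    ∃ t : ℕ, t ≤ D ^ 2 ∧ IsRelPrime P (∑ i ∈ Icc 1 D, ((t : ℂ) ^ i) • Φ^[i] P) := by
  classical
  set fs := UniqueFactorizationMonoid.factors P with hfs
  -- bad values of `t` for a prime factor `q`
  let bad : CX → Finset ℕ := fun q =>
    (Finset.range (D ^ 2 + 1)).filter fun t => q ∣ ∑ i ∈ Icc 1 D, ((t : ℂ) ^ i) • Φ^[i] P
  have hbad : ∀ q ∈ fs, (bad q).card ≤ D := by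
    intro q hq
    have hqp : Prime q := UniqueFactorizationMonoid.prime_of_factor q hq
    haveI : (Ideal.span {q} : Ideal CX).IsPrime := (Ideal.span_singleton_prime hqp.ne_zero).mpr hqp
    set A := CX ⧸ Ideal.span {q} with hA
    haveI : IsDomain A := Ideal.Quotient.isDomain _
    set mk : CX →+* A := Ideal.Quotient.mk (Ideal.span {q}) with hmk
    set f : Polynomial A := ∑ i ∈ Icc 1 D, Polynomial.C (mk (Φ^[i] P)) * Polynomial.X ^ i with hf
    have hcoeff : ∀ i ∈ Icc 1 D, f.coeff i = mk (Φ^[i] P) := by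
      intro i hi
      rw [hf, Polynomial.finsetSum_coeff]
      simp_rw [Polynomial.coeff_C_mul_X_pow]
      rw [Finset.sum_eq_single i (fun j _ hj => if_neg (Ne.symm hj)) (fun h => absurd hi h),
        if_pos rfl]
    -- `f ≠ 0`: otherwise `q` divides `P, ΦP, …, Φ^D P`
    have hf0 : f ≠ 0 := by
      intro h0
      apply hΦ q hqp.irreducible
      intro i hi
      rcases Nat.eq_zero_or_pos i with rfl | hipos
      · exact UniqueFactorizationMonoid.dvd_of_mem_factors hq
      · have hi' : i ∈ Icc 1 D := mem_Icc.mpr ⟨hipos, hi⟩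
        have := hcoeff i hi'
        rw [h0, Polynomial.coeff_zero] at this
        have hmem : Φ^[i] P ∈ Ideal.span {q} := Ideal.Quotient.eq_zero_iff_mem.mp this.symm
        exact Ideal.mem_span_singleton.mp hmem
    have hdeg : f.natDegree ≤ D := by
      rw [hf]
      refine Polynomial.natDegree_sum_le_of_forall_le _ _ fun i hi => ?_
      exact (Polynomial.natDegree_C_mul_X_pow_le _ _).trans (mem_Icc.mp hi).2
    -- bad `t` are roots of `f`
    have hroots : ∀ t ∈ bad q, (t : A) ∈ f.roots := by
      intro t ht
      rw [Polynomial.mem_roots hf0, Polynomial.IsRoot.def, hf, ← mk_sum_pow_smul_iterate_eq_eval]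
      have := (Finset.mem_filter.mp ht).2
      exact Ideal.Quotient.eq_zero_iff_mem.mpr (Ideal.mem_span_singleton.mpr this)
    haveI : CharZero A := charZero_of_injective_algebraMap (algebraMap ℂ A).injective
    calc (bad q).card = ((bad q).image (fun t : ℕ => (t : A))).card :=
          (Finset.card_image_of_injective _ Nat.cast_injective).symm
      _ ≤ f.roots.toFinset.card := Finset.card_le_card fun x hx => by
          obtain ⟨t, ht, rfl⟩ := Finset.mem_image.mp hx
          exact Multiset.mem_toFinset.mpr (hroots t ht)
      _ ≤ Multiset.card f.roots := Multiset.toFinset_card_le _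
      _ ≤ f.natDegree := Polynomial.card_roots' f
      _ ≤ D := hdeg
  -- a good `t ≤ D²`
  have hcard : (fs.toFinset.biUnion bad).card < (Finset.range (D ^ 2 + 1)).card := by
    calc (fs.toFinset.biUnion bad).card ≤ ∑ q ∈ fs.toFinset, (bad q).card := Finset.card_biUnion_le
      _ ≤ ∑ _q ∈ fs.toFinset, D := Finset.sum_le_sum fun q hq => hbad q (Multiset.mem_toFinset.mp hq)
      _ = fs.toFinset.card * D := by rw [Finset.sum_const, smul_eq_mul]
      _ ≤ Multiset.card fs * D := Nat.mul_le_mul_right _ (Multiset.toFinset_card_le _)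
      _ ≤ D * D := Nat.mul_le_mul_right _ (card_factors_le hP hP0)
      _ < D ^ 2 + 1 := by rw [sq]; exact Nat.lt_succ_self _
      _ = _ := (Finset.card_range _).symm
  obtain ⟨t, ht, htbad⟩ := Finset.exists_mem_notMem_of_card_lt_card hcard
  refine ⟨t, by have := Finset.mem_range.mp ht; omega, ?_⟩
  -- coprimality: a common non-unit divisor has a prime factor among `factors P`
  intro d hdP hdQ
  by_contra hdu
  have hd0 : d ≠ 0 := by rintro rfl; exact hP0 (zero_dvd_iff.mp hdP)
  obtain ⟨p, hp, hpd⟩ := WfDvdMonoid.exists_irreducible_factor hdu hd0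
  obtain ⟨q, hq, hpq⟩ := UniqueFactorizationMonoid.exists_mem_factors_of_dvd hP0 hp (hpd.trans hdP)
  apply htbad
  refine Finset.mem_biUnion.mpr ⟨q, Multiset.mem_toFinset.mpr hq, Finset.mem_filter.mpr ⟨ht, ?_⟩⟩
  exact hpq.symm.dvd.trans (hpd.trans hdQ)

/-- **The polynomial `Q` of the proof of Proposition 14**: for `P ∈ ℂ[X]_D` not divisible by
`X₀` nor by `X₂` and `Φ = τ_{(r,s)}` (`r ≠ 0`, `s ≠ 0` not a root of unity), some
`Q = ∑_{i=1}^D tⁱ Φⁱ(P)` with `t ≤ D²` is relatively prime to `P`.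
[cite: NguyenRoy2016, proof of Proposition 14] -/
theorem exists_coprime_tau_combination {P : CX} {D : ℕ} (hP : P.IsHomogeneous D) (hP0 : P ≠ 0)
    (hX0 : ¬ X 0 ∣ P) (hX2 : ¬ X 2 ∣ P) {r s : ℂ} (hr : r ≠ 0) (hs0 : s ≠ 0)
    (hs : ∀ k : ℕ, 0 < k → s ^ k ≠ 1) :
    ∃ t : ℕ, t ≤ D ^ 2 ∧ IsRelPrime P (∑ i ∈ Icc 1 D, ((t : ℂ) ^ i) • (tau r s)^[i] P) :=
  exists_coprime_iterate_combination hP hP0 _ fun _ hirr hdvd =>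
    lemma13 hP hP0 hX0 hX2 hr hs0 hs hirr hdvd

/-- The same for a rational translation `(r, s) ∈ ℚ* × ℚ*`, `s ≠ ±1`.
[cite: NguyenRoy2016, proof of Proposition 14] -/
theorem exists_coprime_tau_combination_rat {P : CX} {D : ℕ} (hP : P.IsHomogeneous D) (hP0 : P ≠ 0)
    (hX0 : ¬ X 0 ∣ P) (hX2 : ¬ X 2 ∣ P) {r s : ℚ} (hr : r ≠ 0) (hs0 : s ≠ 0) (hs1 : s ≠ 1)
    (hs2 : s ≠ -1) :
    ∃ t : ℕ, t ≤ D ^ 2 ∧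
      IsRelPrime P (∑ i ∈ Icc 1 D, ((t : ℂ) ^ i) • (tau (r : ℂ) (s : ℂ))^[i] P) :=
  exists_coprime_tau_combination hP hP0 hX0 hX2 (Rat.cast_ne_zero.mpr hr) (Rat.cast_ne_zero.mpr hs0)
    fun _ hk => rat_cast_pow_ne_one hs1 hs2 hk

/-! ### Scaled translations (integral translates `m^{iD} Φⁱ(P)`) -/

/-- Iterates of a scaled map: `(c Φ)ⁿ P = cⁿ Φⁿ P` for `Φ` linear over `ℂ`. [folklore] -/
theorem iterate_smul_algHom (Φ : CX →ₐ[ℂ] CX) (c : ℂ) (n : ℕ) (P : CX) :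
    (fun Q : CX => c • Φ Q)^[n] P = c ^ n • Φ^[n] P := by
  induction n generalizing P with
  | zero => simp
  | succ n ih =>
    rw [Function.iterate_succ_apply', ih, map_smul, smul_smul, pow_succ, mul_comm,
      Function.iterate_succ_apply']

/-- **A combination `Q = ∑_{i=1}^D tⁱ cⁱ Φⁱ(P)` coprime to `P` for the scaled translation `c Φ`**
(`c ≠ 0`; e.g. `c = m^D` for a common denominator `m` of `r, s`, which makes the translates of an
integer form integral): the scaling does not affect common factors, so Lemma 13 applies.
[cite: NguyenRoy2016, proof of Proposition 14 (the polynomial Q) and Proposition 4 (integrality of m^{4D⌊D^σ⌋}Φⁱ(P̃_D))] -/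
theorem exists_coprime_scaled_tau_combination {P : CX} {D : ℕ} (hP : P.IsHomogeneous D)
    (hP0 : P ≠ 0) (hX0 : ¬ X 0 ∣ P) (hX2 : ¬ X 2 ∣ P) {r s c : ℂ} (hr : r ≠ 0) (hs0 : s ≠ 0)
    (hs : ∀ k : ℕ, 0 < k → s ^ k ≠ 1) (hc : c ≠ 0) :
    ∃ t : ℕ, t ≤ D ^ 2 ∧
      IsRelPrime P (∑ i ∈ Icc 1 D, ((t : ℂ) ^ i) • (fun Q : CX => c • tau r s Q)^[i] P) := by
  refine exists_coprime_iterate_combination hP hP0 _ fun R hirr hdvd => ?_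
  refine lemma13 hP hP0 hX0 hX2 hr hs0 hs hirr fun i hi => ?_
  have h := hdvd i hi
  rw [iterate_smul_algHom] at h
  -- `R ∣ cⁱ Φⁱ P` with `cⁱ` a unit
  have hu : IsUnit (C (c ^ i) : CX) := (isUnit_iff_ne_zero.mpr (pow_ne_zero i hc)).map C
  rw [smul_eq_C_mul] at h
  exact (hu.dvd_mul_left).mp h

/-- The same for a rational translation `(r, s) ∈ ℚ* × ℚ*`, `s ≠ ±1`, and any `c ≠ 0`.
[cite: NguyenRoy2016, proof of Proposition 14] -/
theorem exists_coprime_scaled_tau_combination_rat {P : CX} {D : ℕ} (hP : P.IsHomogeneous D)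
    (hP0 : P ≠ 0) (hX0 : ¬ X 0 ∣ P) (hX2 : ¬ X 2 ∣ P) {r s : ℚ} (hr : r ≠ 0) (hs0 : s ≠ 0)
    (hs1 : s ≠ 1) (hs2 : s ≠ -1) {c : ℂ} (hc : c ≠ 0) :
    ∃ t : ℕ, t ≤ D ^ 2 ∧
      IsRelPrime P (∑ i ∈ Icc 1 D,
        ((t : ℂ) ^ i) • (fun Q : CX => c • tau (r : ℂ) (s : ℂ) Q)^[i] P) :=
  exists_coprime_scaled_tau_combination hP hP0 hX0 hX2 (Rat.cast_ne_zero.mpr hr)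
    (Rat.cast_ne_zero.mpr hs0) (fun _ hk => rat_cast_pow_ne_one hs1 hs2 hk) hc

end NguyenRoy

end Literature.NumberTheory.Transcendental
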